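import Mathlib
import HarnessLib

/-!
# thread_axis — S7′-S (slaving on a level circle) PROVED in CURVE form (ns-idea-8 g2, 2026-08-28T10:37Z; SORRY-FREE)

Companion workfile of `Lines/thread_axis.lean` (skeleton v9, tree f5fb16742da0).  The v9 stub `stub_slavedOnLevelCircle` (S7′-S) asks:
on a compact regular connected level set `{H = 0}` of `(V₂, x₂)` the frozen-bracket identity slaves `∇ₕψ = λ ∇ₕV₂` with ONE constant `λ`.
Here the same statement is PROVED when the level circle is presented by a differentiable HORIZONTAL curve `σ` tangent to the `g`-levels
(`g := V₂`), which is what a Morse-lemma package naturally delivers: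

* `slaved_along_curve` : two `C²` scalars `ψ, g : ℝ³ → ℝ` with `∂₁ψ·∂₀g − ∂₀ψ·∂₁g ≡ 0`, a curve `σ` with `σ′` horizontal, `dg(σ′) = 0` and
  `∇ₕg(σ θ) ≠ 0` for all `θ` ⟹ `∃ λ, ∀ θ, ∇ₕψ(σ θ) = λ ∇ₕg(σ θ)`.

Proof (≈ 120 lines, pure calculus): pointwise `λ(θ) = (ψ₀g₀ + ψ₁g₁)/(g₀² + g₁²)`; differentiate the bracket (product rule), use the symmetry
of mixed partials (`ContDiffAt.isSymmSndFDerivAt`) and `σ′ ∥ (g₁, −g₀, 0)` to get `λ′ ≡ 0` (`key_alg`, `alg2`), then `is_const_of_deriv_eq_zero`.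

CONSEQUENCE FOR THE SKELETON (v10 plan, NOT applied to the tree skeleton in this generation — v9's booked statements stay stable): restate S7′-M
`stub_morseLevelPackage` so that it also delivers a differentiable horizontal covering curve of the level circle (`∃ σ σ′, (∀ θ, HasDerivAt σ (σ′ θ) θ)
∧ (∀ θ, H (σ θ) = 0) ∧ (∀ y, H y = 0 → ∃ θ, σ θ = y)`, replacing `IsConnected {H = 0}`); then S7′-S is THIS theorem (with `g := fun x => V x 2`,
the bracket from `hbr` via `fderiv_apply_two`, `σ′ θ 2 = 0` and `dg(σ′) = 0` read off `fderiv H (σ θ) (σ′ θ) = 0`), and the skeleton's sorries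
drop 7 → 6.  No summit, crux or stub of record is discharged by this file; 19708 / 20428 remain OPEN.
-/

namespace Summit.NavierStokesRegularity.NavierStokesRegularity.Cruxes.PoloidalWindowRigidity.ThreadAxis.Slave

/-- Expansion of a CLM value on a horizontal vector of `ℝ³`. -/
theorem apply_horizontal (L : EuclideanSpace ℝ (Fin 3) →L[ℝ] ℝ) {w : EuclideanSpace ℝ (Fin 3)} (hw : w 2 = 0) :
    L w = w 0 * L (EuclideanSpace.single 0 1) + w 1 * L (EuclideanSpace.single 1 1) := by
  have hw' : w = w 0 • EuclideanSpace.single 0 1 + w 1 • EuclideanSpace.single 1 1 := by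
    have h := (EuclideanSpace.basisFun (Fin 3) ℝ).sum_repr w
    rw [Fin.sum_univ_three] at h
    simp only [EuclideanSpace.basisFun_repr, EuclideanSpace.basisFun_apply] at h
    rw [hw, zero_smul, add_zero] at h
    exact h.symm
  conv_lhs => rw [hw']
  rw [map_add, map_smul, map_smul, smul_eq_mul, smul_eq_mul]

/-- Partial-derivative functions of a `C²` scalar are `C¹`. -/
theorem contDiff_partial {f : EuclideanSpace ℝ (Fin 3) → ℝ} (hf : ContDiff ℝ 2 f) (u : EuclideanSpace ℝ (Fin 3)) :
    ContDiff ℝ 1 (fun x => fderiv ℝ f x u) :=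
  (hf.fderiv_right (m := 1) (by norm_num)).clm_apply contDiff_const

/-- Mixed second partials of a `C²` scalar commute. -/
theorem partial_comm {f : EuclideanSpace ℝ (Fin 3) → ℝ} (hf : ContDiff ℝ 2 f) (y v w : EuclideanSpace ℝ (Fin 3)) :
    fderiv ℝ (fun x => fderiv ℝ f x v) y w = fderiv ℝ (fun x => fderiv ℝ f x w) y v := by
  have hd : DifferentiableAt ℝ (fderiv ℝ f) y :=
    ((hf.fderiv_right (m := 1) (by norm_num)).differentiable one_ne_zero).differentiableAt
  have key : ∀ u z : EuclideanSpace ℝ (Fin 3),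
      fderiv ℝ (fun x => fderiv ℝ f x u) y z = fderiv ℝ (fderiv ℝ f) y z u := by
    intro u z
    rw [fderiv_clm_apply hd (differentiableAt_const u)]
    simp only [fderiv_fun_const, Pi.zero_apply, ContinuousLinearMap.comp_zero, zero_add,
      ContinuousLinearMap.flip_apply]
  rw [key v w, key w v]
  exact (hf.contDiffAt.isSymmSndFDerivAt (by simp)) w v

/-- Chain rule along a horizontal curve for a partial-derivative function. -/
theorem hasDerivAt_partial_comp {f : EuclideanSpace ℝ (Fin 3) → ℝ} (hf : ContDiff ℝ 2 f) (u : EuclideanSpace ℝ (Fin 3))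
    {σ σ' : ℝ → EuclideanSpace ℝ (Fin 3)} (hσ : ∀ θ, HasDerivAt σ (σ' θ) θ) (hσ2 : ∀ θ, σ' θ 2 = 0) (θ : ℝ) :
    HasDerivAt (fun t => fderiv ℝ f (σ t) u)
      (σ' θ 0 * fderiv ℝ (fun x => fderiv ℝ f x u) (σ θ) (EuclideanSpace.single 0 1) +
        σ' θ 1 * fderiv ℝ (fun x => fderiv ℝ f x u) (σ θ) (EuclideanSpace.single 1 1)) θ := by
  have hF : Differentiable ℝ (fun x => fderiv ℝ f x u) := (contDiff_partial hf u).differentiable one_ne_zero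
  have h := (hF (σ θ)).hasFDerivAt.comp_hasDerivAt θ (hσ θ)
  rw [apply_horizontal _ (hσ2 θ)] at h
  exact h

/-- Differentiated bracket: if `P y * Q y - R y * S y = 0` identically for differentiable `P Q R S`, then the
directional derivative of the bracket vanishes. -/
theorem bracket_deriv {P Q R S : EuclideanSpace ℝ (Fin 3) → ℝ} (hP : Differentiable ℝ P) (hQ : Differentiable ℝ Q)
    (hR : Differentiable ℝ R) (hS : Differentiable ℝ S) (h : ∀ y, P y * Q y - R y * S y = 0)
    (y w : EuclideanSpace ℝ (Fin 3)) :
    P y * fderiv ℝ Q y w + Q y * fderiv ℝ P y w - (R y * fderiv ℝ S y w + S y * fderiv ℝ R y w) = 0 := by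
  have hBd : HasFDerivAt (fun y => P y * Q y - R y * S y)
      (P y • fderiv ℝ Q y + Q y • fderiv ℝ P y - (R y • fderiv ℝ S y + S y • fderiv ℝ R y)) y :=
    ((hP y).hasFDerivAt.mul (hQ y).hasFDerivAt).sub ((hR y).hasFDerivAt.mul (hS y).hasFDerivAt)
  have hB0 : HasFDerivAt (fun y => P y * Q y - R y * S y) (0 : EuclideanSpace ℝ (Fin 3) →L[ℝ] ℝ) y := by
    have hz : (fun y => P y * Q y - R y * S y) = fun _ => (0 : ℝ) := funext h
    rw [hz]; exact hasFDerivAt_const 0 y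
  have heq := congrArg (fun L : EuclideanSpace ℝ (Fin 3) →L[ℝ] ℝ => L w) (hBd.unique hB0)
  simpa using heq

/-- The pure algebra of the slaving step. -/
theorem key_alg (a b c d p q l X00 X01 X10 X11 Y00 Y01 Y10 Y11 : ℝ)
    (hreg : c ≠ 0 ∨ d ≠ 0) (ha : a = l * c) (hb : b = l * d) (E4 : p * c + q * d = 0)
    (DB0 : b * Y00 + c * X10 - (a * Y10 + d * X00) = 0)
    (DB1 : b * Y01 + c * X11 - (a * Y11 + d * X01) = 0)
    (Sψ : X01 = X10) (Sg : Y01 = Y10) :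
    c * ((p * X00 + q * X01) - l * (p * Y00 + q * Y01)) +
      d * ((p * X10 + q * X11) - l * (p * Y10 + q * Y11)) = 0 := by
  subst ha hb
  have hDn : 0 < c ^ 2 + d ^ 2 := by
    rcases hreg with h | h
    · have := sq_pos_iff.mpr h; nlinarith [sq_nonneg d]
    · have := sq_pos_iff.mpr h; nlinarith [sq_nonneg c]
  obtain ⟨μ, hp, hq⟩ : ∃ μ : ℝ, p = μ * d ∧ q = -(μ * c) := by
    refine ⟨(p * d - q * c) / (c ^ 2 + d ^ 2), ?_, ?_⟩
    · rw [div_mul_eq_mul_div, eq_div_iff hDn.ne']; linear_combination c * E4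
    · rw [div_mul_eq_mul_div, ← neg_div, eq_div_iff hDn.ne']; linear_combination d * E4
  subst hp hq
  linear_combination (-(μ * (c ^ 2 + d ^ 2))) * Sψ + (μ * l * (c ^ 2 + d ^ 2)) * Sg +
    (-(μ * c)) * DB0 + (-(μ * d)) * DB1

/-- The quotient-rule numerator vanishes. -/
theorem alg2 (a b c d a' b' c' d' : ℝ) (hD : c * c + d * d ≠ 0)
    (h1 : a = (a * c + b * d) / (c * c + d * d) * c) (h2 : b = (a * c + b * d) / (c * c + d * d) * d)
    (K : c * (a' - (a * c + b * d) / (c * c + d * d) * c') + d * (b' - (a * c + b * d) / (c * c + d * d) * d') = 0) :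
    ((a' * c + a * c') + (b' * d + b * d')) * (c * c + d * d) -
      (a * c + b * d) * ((c' * c + c * c') + (d' * d + d * d')) = 0 := by
  set l := (a * c + b * d) / (c * c + d * d) with hl
  have hlD : l * (c * c + d * d) = a * c + b * d := by rw [hl]; exact div_mul_cancel₀ _ hD
  linear_combination (c * c + d * d) * K + ((c * c + d * d) * c') * h1 + ((c * c + d * d) * d') * h2 +
    (2 * (c * c' + d * d')) * hlD

/-- **S7′-S in curve form (sorry-free).** Two `C²` scalars `ψ, g` on `ℝ³` with vanishing horizontal Jacobian
`∂₁ψ ∂₀g − ∂₀ψ ∂₁g ≡ 0`; a differentiable horizontal curve `σ` tangent to the `g`-levels along which `∇ₕ g ≠ 0`.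
Then `∇ₕψ = λ ∇ₕ g` along `σ` with ONE constant `λ`. -/
theorem slaved_along_curve (ψ g : EuclideanSpace ℝ (Fin 3) → ℝ) (hψ : ContDiff ℝ 2 ψ) (hg : ContDiff ℝ 2 g)
    (hbr : ∀ y, fderiv ℝ ψ y (EuclideanSpace.single 1 1) * fderiv ℝ g y (EuclideanSpace.single 0 1) -
      fderiv ℝ ψ y (EuclideanSpace.single 0 1) * fderiv ℝ g y (EuclideanSpace.single 1 1) = 0)
    (σ σ' : ℝ → EuclideanSpace ℝ (Fin 3)) (hσ : ∀ θ, HasDerivAt σ (σ' θ) θ) (hσ2 : ∀ θ, σ' θ 2 = 0)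
    (hσg : ∀ θ, fderiv ℝ g (σ θ) (σ' θ) = 0)
    (hreg : ∀ θ, fderiv ℝ g (σ θ) (EuclideanSpace.single 0 1) ≠ 0 ∨ fderiv ℝ g (σ θ) (EuclideanSpace.single 1 1) ≠ 0) :
    ∃ lam : ℝ, ∀ θ, fderiv ℝ ψ (σ θ) (EuclideanSpace.single 0 1) = lam * fderiv ℝ g (σ θ) (EuclideanSpace.single 0 1) ∧
      fderiv ℝ ψ (σ θ) (EuclideanSpace.single 1 1) = lam * fderiv ℝ g (σ θ) (EuclideanSpace.single 1 1) := by
  -- the four first partials along σ: a = ψ₀, b = ψ₁, c = g₀, d = g₁; N = ac+bd, D = c²+d², λ = N/D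
  have hDpos : ∀ θ, 0 < fderiv ℝ g (σ θ) (EuclideanSpace.single 0 1) * fderiv ℝ g (σ θ) (EuclideanSpace.single 0 1) +
      fderiv ℝ g (σ θ) (EuclideanSpace.single 1 1) * fderiv ℝ g (σ θ) (EuclideanSpace.single 1 1) := by
    intro θ
    rcases hreg θ with h | h
    · have := mul_self_pos.mpr h; nlinarith [mul_self_nonneg (fderiv ℝ g (σ θ) (EuclideanSpace.single 1 1))]
    · have := mul_self_pos.mpr h; nlinarith [mul_self_nonneg (fderiv ℝ g (σ θ) (EuclideanSpace.single 0 1))]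
  -- pointwise slaving with λ(θ)
  have hpt : ∀ θ,
      fderiv ℝ ψ (σ θ) (EuclideanSpace.single 0 1) =
        (fderiv ℝ ψ (σ θ) (EuclideanSpace.single 0 1) * fderiv ℝ g (σ θ) (EuclideanSpace.single 0 1) +
          fderiv ℝ ψ (σ θ) (EuclideanSpace.single 1 1) * fderiv ℝ g (σ θ) (EuclideanSpace.single 1 1)) /
        (fderiv ℝ g (σ θ) (EuclideanSpace.single 0 1) * fderiv ℝ g (σ θ) (EuclideanSpace.single 0 1) +
          fderiv ℝ g (σ θ) (EuclideanSpace.single 1 1) * fderiv ℝ g (σ θ) (EuclideanSpace.single 1 1)) *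
        fderiv ℝ g (σ θ) (EuclideanSpace.single 0 1) ∧
      fderiv ℝ ψ (σ θ) (EuclideanSpace.single 1 1) =
        (fderiv ℝ ψ (σ θ) (EuclideanSpace.single 0 1) * fderiv ℝ g (σ θ) (EuclideanSpace.single 0 1) +
          fderiv ℝ ψ (σ θ) (EuclideanSpace.single 1 1) * fderiv ℝ g (σ θ) (EuclideanSpace.single 1 1)) /
        (fderiv ℝ g (σ θ) (EuclideanSpace.single 0 1) * fderiv ℝ g (σ θ) (EuclideanSpace.single 0 1) +
          fderiv ℝ g (σ θ) (EuclideanSpace.single 1 1) * fderiv ℝ g (σ θ) (EuclideanSpace.single 1 1)) *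
        fderiv ℝ g (σ θ) (EuclideanSpace.single 1 1) := by
    intro θ
    constructor
    · rw [div_mul_eq_mul_div, eq_div_iff (hDpos θ).ne']
      linear_combination (-(fderiv ℝ g (σ θ) (EuclideanSpace.single 1 1))) * hbr (σ θ)
    · rw [div_mul_eq_mul_div, eq_div_iff (hDpos θ).ne']
      linear_combination (fderiv ℝ g (σ θ) (EuclideanSpace.single 0 1)) * hbr (σ θ)
  -- derivatives of the four partials along σ
  have ha := fun θ => hasDerivAt_partial_comp hψ (EuclideanSpace.single 0 1) hσ hσ2 θ
  have hb := fun θ => hasDerivAt_partial_comp hψ (EuclideanSpace.single 1 1) hσ hσ2 θ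
  have hc := fun θ => hasDerivAt_partial_comp hg (EuclideanSpace.single 0 1) hσ hσ2 θ
  have hd := fun θ => hasDerivAt_partial_comp hg (EuclideanSpace.single 1 1) hσ hσ2 θ
  -- differentiability of the partial-derivative functions
  have dψ0 := (contDiff_partial hψ (EuclideanSpace.single 0 1)).differentiable one_ne_zero
  have dψ1 := (contDiff_partial hψ (EuclideanSpace.single 1 1)).differentiable one_ne_zero
  have dg0 := (contDiff_partial hg (EuclideanSpace.single 0 1)).differentiable one_ne_zero
  have dg1 := (contDiff_partial hg (EuclideanSpace.single 1 1)).differentiable one_ne_zero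
  -- λ has derivative zero
  have hlam : ∀ θ, HasDerivAt (fun t =>
      (fderiv ℝ ψ (σ t) (EuclideanSpace.single 0 1) * fderiv ℝ g (σ t) (EuclideanSpace.single 0 1) +
          fderiv ℝ ψ (σ t) (EuclideanSpace.single 1 1) * fderiv ℝ g (σ t) (EuclideanSpace.single 1 1)) /
        (fderiv ℝ g (σ t) (EuclideanSpace.single 0 1) * fderiv ℝ g (σ t) (EuclideanSpace.single 0 1) +
          fderiv ℝ g (σ t) (EuclideanSpace.single 1 1) * fderiv ℝ g (σ t) (EuclideanSpace.single 1 1))) 0 θ := by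
    intro θ
    have hN := ((ha θ).mul (hc θ)).add ((hb θ).mul (hd θ))
    have hD := ((hc θ).mul (hc θ)).add ((hd θ).mul (hd θ))
    have hq := hN.div hD (hDpos θ).ne'
    -- the ingredients of the key identity at σ θ
    have E4 : σ' θ 0 * fderiv ℝ g (σ θ) (EuclideanSpace.single 0 1) + σ' θ 1 * fderiv ℝ g (σ θ) (EuclideanSpace.single 1 1) = 0 := by
      rw [← apply_horizontal _ (hσ2 θ)]; exact hσg θ
    have DB0 := bracket_deriv dψ1 dg0 dψ0 dg1 hbr (σ θ) (EuclideanSpace.single 0 1)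
    have DB1 := bracket_deriv dψ1 dg0 dψ0 dg1 hbr (σ θ) (EuclideanSpace.single 1 1)
    have Sψ := partial_comm hψ (σ θ) (EuclideanSpace.single 0 1) (EuclideanSpace.single 1 1)
    have Sg := partial_comm hg (σ θ) (EuclideanSpace.single 0 1) (EuclideanSpace.single 1 1)
    have K := key_alg _ _ _ _ (σ' θ 0) (σ' θ 1) _ _ _ _ _ _ _ _ _ (hreg θ) (hpt θ).1 (hpt θ).2 E4 DB0 DB1 Sψ Sg
    have A := alg2 _ _ _ _ _ _ _ _ (hDpos θ).ne' (hpt θ).1 (hpt θ).2 K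
    refine (hq.congr_deriv ?_)
    simp only [Pi.add_apply, Pi.mul_apply]
    rw [div_eq_zero_iff]; left; linear_combination A
  -- hence λ is constant
  have hdiff : Differentiable ℝ (fun t =>
      (fderiv ℝ ψ (σ t) (EuclideanSpace.single 0 1) * fderiv ℝ g (σ t) (EuclideanSpace.single 0 1) +
          fderiv ℝ ψ (σ t) (EuclideanSpace.single 1 1) * fderiv ℝ g (σ t) (EuclideanSpace.single 1 1)) /
        (fderiv ℝ g (σ t) (EuclideanSpace.single 0 1) * fderiv ℝ g (σ t) (EuclideanSpace.single 0 1) +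
          fderiv ℝ g (σ t) (EuclideanSpace.single 1 1) * fderiv ℝ g (σ t) (EuclideanSpace.single 1 1))) :=
    fun θ => (hlam θ).differentiableAt
  have hconst := is_const_of_deriv_eq_zero hdiff (fun θ => (hlam θ).deriv)
  refine ⟨(fderiv ℝ ψ (σ 0) (EuclideanSpace.single 0 1) * fderiv ℝ g (σ 0) (EuclideanSpace.single 0 1) +
          fderiv ℝ ψ (σ 0) (EuclideanSpace.single 1 1) * fderiv ℝ g (σ 0) (EuclideanSpace.single 1 1)) /
        (fderiv ℝ g (σ 0) (EuclideanSpace.single 0 1) * fderiv ℝ g (σ 0) (EuclideanSpace.single 0 1) +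
          fderiv ℝ g (σ 0) (EuclideanSpace.single 1 1) * fderiv ℝ g (σ 0) (EuclideanSpace.single 1 1)), fun θ => ?_⟩
  rw [← hconst θ 0]
  exact hpt θ

end Summit.NavierStokesRegularity.NavierStokesRegularity.Cruxes.PoloidalWindowRigidity.ThreadAxis.Slave
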